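import Literature.NumberTheory.DiophantineGeometry.GenEllFullGalois
import Literature.NumberTheory.EllipticCurves.GaloisActionProofs
import Literature.NumberTheory.EllipticCurves.MultiplicativeTransvectionPrimeToVProofs
import Literature.GroupTheory.SpecificGroups.GL2SubgroupOrderDivisibleContainsSL2
import HarnessLib

/-!
# [GenEll] Thm 3.8 / [IUTchIV] Cor 2.2 (P6): the image of Galois in `Aut(E[l])` contains `SL₂(𝔽_l)`

S. Mochizuki, *Arithmetic elliptic curves in general position*, Math. J. Okayama Univ. **52** (2010)
[cite: MochizukiGenEll2010], proof of Theorem 3.8, p. 20, and *Inter-universal Teichmüller theory IV*,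
proof of Corollary 2.2, step (P6), p. 46 [cite: Mochizuki2012, IUTchIV Cor 2.2 p.46]:

> (P6) follows formally from (P2), (P4), and [GenEll], Lemma 3.1, (iii).

Here (P2) = "`E[l]` is of rank two and the mod-`l` representation is irreducible" (no `l`-cyclic
subgroup scheme), (P4) = "some element of Galois acts on `E[l]` with order `l`" (a Tate-curve
transvection at a prime of multiplicative reduction whose local height is prime to `l`), and the
conclusion (P6) = "the image of `Γ_L → GL₂(𝔽_l)` contains `SL₂(𝔽_l)`".  This file is the GLUE between
the abstract group theory of `GL2SubgroupOrderDivisibleContainsSL2.lean` (Serre 1972 Prop. 15 form of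
[GenEll] Lem. 3.1 (iii): an irreducible subgroup of `GL₂(𝔽_l)` with an element of order `l` contains
`SL₂(𝔽_l)`, basis-free over `ρ : G →* Multiplicative (AddAut A)`) and the tree's elliptic-curve
vocabulary: `WeierstrassCurve.geomTorsion`, `galoisRepTorsion`, `HasIrreducibleModPGaloisRep`
(`EllipticCurves/GaloisAction.lean`), `EllPoint.AdmitsLCyclic` (`GenEllLCyclic.lean`) and
`EllPoint.ImageModLContainsSL2` (`GenEllFullGalois.lean`).  PROVED:

* `EllPoint.natCard_geomTorsion_eq_sq`, `EllPoint.finrank_geomTorsion_eq_two` — `#E[l] = l²` (the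
  tree's theorem `card_torsionPoints_eq_sq_holds`, Silverman AEC III.6.4(b)) and `dim_{𝔽_l} E[l] = 2`;
* `EllPoint.hasIrreducibleModPGaloisRep_of_not_admitsLCyclic` — rank two and no `l`-cyclic subgroup
  scheme ⇒ the mod-`l` representation is irreducible;
* `EllPoint.imageModLContainsSL2_of_irreducible_of_orderOf_eq` — rank two, irreducible, and a Galois
  element of order `l` on `E[l]` ⇒ `EllPoint.ImageModLContainsSL2 P l`;
* `EllPoint.imageModLContainsSL2_of_not_admitsLCyclic_of_orderOf_eq` — the (P2)+(P4) ⇒ (P6) form;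
* `EllPoint.imageModLContainsSL2_of_not_admitsLCyclic_of_hasMultiplicativeReductionAt` — the same with
  (P4) DISCHARGED by the Tate-curve transvection at a prime `v ∤ l` of multiplicative reduction with
  `l ∤ ord_v(Δ_min)` (the tree's theorem
  `WeierstrassCurve.exists_orderOf_galoisRepTorsion_eq_of_hasMultiplicativeReductionAt_of_not_dvd`,
  Silverman *ATAEC* V.6 Prop. 6.1, seat abc-iut-S5).

Proof-only; no definitions; no named-fact hypotheses.
-/

noncomputable section

namespace Literature.NumberTheory.DiophantineGeometry.GenEll

open Literature.GroupTheory.SpecificGroups Module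

namespace EllPoint

variable (P : EllPoint) (l : ℕ) [Fact l.Prime]

/-- `#E[l] = l²` for the geometric `l`-torsion of an elliptic curve over a number field (the tree's
theorem `card_torsionPoints_eq_sq_holds`, Silverman AEC III.6.4(b); `l ≠ 0` in characteristic `0`).
[cite: SilvermanAEC2009, Cor. III.6.4(b)] -/
theorem natCard_geomTorsion_eq_sq : Nat.card (P.W.geomTorsion (l : ℤ)) = l ^ 2 :=
  P.W.card_torsionPoints_eq_sq_holds (AlgebraicClosure P.F)
    (by exact_mod_cast (Fact.out : l.Prime).ne_zero)

/-- `E[l]` is `2`-dimensional over `𝔽_l` (for Mathlib's `ZMod l`-module structure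
`AddSubgroup.torsionBy.zmodModule` on the `l`-torsion). [cite: Mochizuki2012, IUTchIV Cor 2.2 p.44] -/
theorem finrank_geomTorsion_eq_two :
    letI : Module (ZMod l) (P.W.geomTorsion (l : ℤ)) := AddSubgroup.torsionBy.zmodModule
    finrank (ZMod l) (P.W.geomTorsion (l : ℤ)) = 2 := by
  letI : Module (ZMod l) (P.W.geomTorsion (l : ℤ)) := AddSubgroup.torsionBy.zmodModule
  have hl : l.Prime := Fact.out
  have hcard := P.natCard_geomTorsion_eq_sq l
  haveI : Finite (P.W.geomTorsion (l : ℤ)) :=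
    Nat.finite_of_card_ne_zero (by rw [hcard]; exact pow_ne_zero _ hl.ne_zero)
  haveI : Module.Finite (ZMod l) (P.W.geomTorsion (l : ℤ)) := Module.Finite.of_finite
  have h := Module.natCard_eq_pow_finrank (K := ZMod l) (V := P.W.geomTorsion (l : ℤ))
  rw [hcard, Nat.card_zmod] at h
  exact (Nat.pow_right_injective hl.two_le h).symm

/-- **(P2): rank two and no `l`-cyclic subgroup scheme ⇒ the mod-`l` Galois representation is
irreducible** (a `Γ_F`-stable subgroup of `E[l] ≅ 𝔽_l²` other than `0`, `E[l]` has order `l`).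
[cite: Mochizuki2012, IUTchIV Cor 2.2 p.44] -/
theorem hasIrreducibleModPGaloisRep_of_not_admitsLCyclic (h : ¬ P.AdmitsLCyclic l) :
    P.W.HasIrreducibleModPGaloisRep l := by
  letI : Module (ZMod l) (P.W.geomTorsion (l : ℤ)) := AddSubgroup.torsionBy.zmodModule
  have hA := P.finrank_geomTorsion_eq_two l
  intro H hH
  refine stable_addSubgroup_eq_bot_or_top_of_card hA (P.W.galoisRepTorsion (l : ℤ)) ?_ H ?_
  · intro H' hH' hc
    exact h ⟨H', fun σ x hx => hH' σ x hx, hc⟩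
  · exact fun σ x hx => hH σ x hx

/-- **(P2) + (P4) ⇒ (P6)**: if `E[l]` has rank two, the mod-`l` representation is irreducible, and
some `σ ∈ Γ_F` acts on `E[l]` with order `l`, then every `𝔽_l`-linear endomorphism of `E[l]` of
determinant `1` is the action of a Galois element — "the image of `Γ_F` in `GL₂(𝔽_l)` contains
`SL₂(𝔽_l)`" ([GenEll] Lem. 3.1 (iii) in J.-P. Serre's Prop. 15 form, through the basis-free bridge
`ofAdd_toAddEquiv_mem_range_of_irreducible_of_orderOf_eq`). [cite: Mochizuki2012, IUTchIV Cor 2.2 p.46] -/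
theorem imageModLContainsSL2_of_irreducible_of_orderOf_eq (hirr : P.W.HasIrreducibleModPGaloisRep l)
    (hord : ∃ σ : Field.absoluteGaloisGroup P.F, orderOf (P.W.galoisRepTorsion (l : ℤ) σ) = l) :
    P.ImageModLContainsSL2 l := by
  letI : Module (ZMod l) (P.W.geomTorsion (l : ℤ)) := AddSubgroup.torsionBy.zmodModule
  have hA := P.finrank_geomTorsion_eq_two l
  haveI : FiniteDimensional (ZMod l) (P.W.geomTorsion (l : ℤ)) := .of_finrank_eq_succ hA
  intro f hf
  have hdet : LinearMap.det f ≠ 0 := by rw [hf]; exact one_ne_zero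
  set e : P.W.geomTorsion (l : ℤ) ≃ₗ[ZMod l] P.W.geomTorsion (l : ℤ) :=
    LinearMap.equivOfDetNeZero f hdet with he_def
  have he : (e : P.W.geomTorsion (l : ℤ) →ₗ[ZMod l] P.W.geomTorsion (l : ℤ)) = f := rfl
  have hmem := ofAdd_toAddEquiv_mem_range_of_irreducible_of_orderOf_eq hA
    (P.W.galoisRepTorsion (l : ℤ)) (fun H hH => hirr H fun σ x hx => hH σ x hx) hord e
    (by rw [he]; exact hf)
  obtain ⟨σ, hσ⟩ := hmem
  refine ⟨σ, fun x => ?_⟩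
  calc σ • x = (P.W.galoisRepTorsion (l : ℤ) σ).toAdd x := rfl
    _ = (Multiplicative.ofAdd e.toAddEquiv).toAdd x := by rw [hσ]
    _ = f x := rfl

/-- **(P2) + (P4) ⇒ (P6), with (P2) as "no `l`-cyclic subgroup scheme"** ([GenEll] proof of
Thm. 3.8: outside the exceptional set of Lemma 3.7 there is no `l`-cyclic subgroup scheme, so the
mod-`l` representation is irreducible; with an element of order `l` the image contains `SL₂(𝔽_l)`).
[cite: MochizukiGenEll2010, Thm 3.8 p.20] -/
theorem imageModLContainsSL2_of_not_admitsLCyclic_of_orderOf_eq (hno : ¬ P.AdmitsLCyclic l)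
    (hord : ∃ σ : Field.absoluteGaloisGroup P.F, orderOf (P.W.galoisRepTorsion (l : ℤ) σ) = l) :
    P.ImageModLContainsSL2 l :=
  P.imageModLContainsSL2_of_irreducible_of_orderOf_eq l
    (P.hasIrreducibleModPGaloisRep_of_not_admitsLCyclic l hno) hord

/-- **(P2) + (P4) ⇒ (P6) with (P4) discharged** ([IUTchIV] Cor. 2.2, p. 46; [GenEll] Thm. 3.8's
"final portion" at level `n = 1`): if `E` admits no `l`-cyclic subgroup scheme and has a prime `v ∤ l`
of multiplicative reduction with `l ∤ ord_v(Δ_min)` (= the local height `h_v`), then the image of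
`Γ_F` in `Aut(E[l])` contains `SL₂(𝔽_l)` — the Tate curve at `v` supplies `σ ∈ Γ_F` of order `l` on
`E[l]` (Silverman *ATAEC* V.6 Prop. 6.1, the tree's
`exists_orderOf_galoisRepTorsion_eq_of_hasMultiplicativeReductionAt_of_not_dvd`).
[cite: Mochizuki2012, IUTchIV Cor 2.2 p.46] -/
theorem imageModLContainsSL2_of_not_admitsLCyclic_of_hasMultiplicativeReductionAt
    (hno : ¬ P.AdmitsLCyclic l) {v : IsDedekindDomain.HeightOneSpectrum (NumberField.RingOfIntegers P.F)}
    (hv : P.W.HasMultiplicativeReductionAt v)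
    (hvl : (l : NumberField.RingOfIntegers P.F) ∉ v.asIdeal)
    (hndvd : ¬ l ∣ P.W.ordMinimalDiscriminant v) : P.ImageModLContainsSL2 l := by
  obtain ⟨σ, -, hσ⟩ :=
    P.W.exists_orderOf_galoisRepTorsion_eq_of_hasMultiplicativeReductionAt_of_not_dvd hv
      (Fact.out : l.Prime) hvl hndvd
  exact P.imageModLContainsSL2_of_not_admitsLCyclic_of_orderOf_eq l hno ⟨σ, hσ⟩

end EllPoint

end Literature.NumberTheory.DiophantineGeometry.GenEll

end
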